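import Summits.AtomisticToContinuum.HydrodynamicLimit.Theses.JParityClosure
import Literature.MathematicalPhysics.KineticTheory.HardSphereEulerProofs
import Literature.Analysis.FluidPDE.ConfinedHardSphereFlowShortBad
import Summits.AtomisticToContinuum.HydrodynamicLimit.Theorems.LocalSecondLaw.Negative.FreeVolume

/-!
# Crux `LocalSecondLaw` (stmt-AtomisticToContinuum-13081) — strategy census, kernel-checked part

Crux-strategist seat `planner-cstrat-stmt-AtomisticToContinuum-13081-s1-0` (2026-08-17).  Companion of
`Cruxes/LocalSecondLaw/STRATEGY-CENSUS.md` (imports only the route file + Literature; `LocalSecondLawPreShock` below is a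
byte-copy of the decl of the same name in `Cruxes/LocalSecondLaw/Restatement.lean`); every signature quoted there under `## Strengthen` and
`## Decomposition` is a declaration of this file, and the two structural claims the census rests on are
PROVED here (no `sorry`):

* `localSecondLaw_of_postHorizon` — **the horizon `T` is idle in the filed decl**: the "post-horizon half"
  `LocalSecondLawPostHorizon` (the filed text with the extra hypothesis `T ≤ τ`) ALONE implies the filed crux,
  because a classical hard-sphere Euler solution on `[0,T)` restricts to one on `[0,τ)`
  (`isHardSphereEulerSolution_restrict`) and the conclusion reads the solution only at `t = 0`.  Hence the
  time split `LocalSecondLawPreShock ∧ LocalSecondLawPostHorizon → LocalSecondLaw`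
  (`localSecondLaw_of_preShock_of_postHorizon`, also proved) is NOT an admissible decomposition: its second
  piece is the crux reworded (`localSecondLaw_iff_postHorizon`).
* `hsExcessFreeEnergy_eq_zero_of_gt` — the typed equation of state is JUNK above reduced density `6/π`
  (`hsExcessFreeEnergy η = 0`; physically `+∞`): the kernel-checked half of the census' negation attempt N2
  (which fails: the branch is kinematically unreachable by the cone-mollified density, census N2).
* `localSecondLaw_of_anyLaw` — the Markov / law-free strengthening `LocalSecondLawAnyLaw` (hypothesis on the
  initial MACROSTATE only: any probability laws `P N` with the `t = 0` LLN) implies the crux; it is the form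
  that would admit induction over time windows, and it is false on paper by velocity reversal
  (`Literature.Barriers.AtomisticToContinuum.VelocityReversalBarrier`) — see the census `## Strengthen`.
-/

noncomputable section

open MeasureTheory Filter Set Topology
open Literature.MathematicalPhysics.KineticTheory Literature.Analysis.FluidPDE

namespace Summit.AtomisticToContinuum.HydrodynamicLimit.Cruxes.LocalSecondLaw.StrategyCensus

open Summit.AtomisticToContinuum.HydrodynamicLimit.Theses

/-! ## Restriction of classical solutions to a shorter horizon -/

/-- One-sided time derivatives within `[0,T')` and within `[0,T)` agree on `[0,T')` when `T' ≤ T`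
(the two time sets coincide near every point of `[0,T')`). [folklore] -/
theorem timeDerivWithin_Ico_restrict {F : Type*} [NormedAddCommGroup F] [NormedSpace ℝ F]
    {T T' : ℝ} (hT' : T' ≤ T) (w : ℝ → T3 → F) {t : ℝ} (ht : t ∈ Ico (0 : ℝ) T') (x : T3) :
    Literature.Analysis.FunctionSpaces.Torus.timeDerivWithin (Ico 0 T') w t x =
      Literature.Analysis.FunctionSpaces.Torus.timeDerivWithin (Ico 0 T) w t x := by
  unfold Literature.Analysis.FunctionSpaces.Torus.timeDerivWithin
  apply derivWithin_congr_set
  refine Filter.eventuallyEq_set.2 ?_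
  filter_upwards [Iio_mem_nhds ht.2] with s hs
  exact ⟨fun h => ⟨h.1, lt_of_lt_of_le h.2 hT'⟩, fun h => ⟨h.1, hs⟩⟩

/-- **Restriction lemma.** A classical hard-sphere Euler solution on `[0,T)` is one on `[0,T')` for every
`T' ≤ T`. [folklore] -/
theorem isHardSphereEulerSolution_restrict {σ T T' : ℝ} {ρ θ : ℝ → T3 → ℝ} {u : ℝ → T3 → V3}
    (h : IsHardSphereEulerSolution σ T ρ u θ) (hT' : T' ≤ T) :
    IsHardSphereEulerSolution σ T' ρ u θ := by
  have hsub : Ico (0 : ℝ) T' ⊆ Ico 0 T := Ico_subset_Ico_right hT'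
  refine ⟨h.smooth_density.mono hsub, h.smooth_velocity.mono hsub, h.smooth_temperature.mono hsub,
    fun t ht => h.density_pos t (hsub ht), fun t ht => h.temperature_pos t (hsub ht), ?_, ?_, ?_⟩
  · intro t ht x
    rw [timeDerivWithin_Ico_restrict hT' ρ ht x]
    exact h.mass t (hsub ht) x
  · intro t ht x
    rw [timeDerivWithin_Ico_restrict hT' (fun s y => ρ s y • u s y) ht x]
    exact h.momentum t (hsub ht) x
  · intro t ht x
    rw [timeDerivWithin_Ico_restrict hT' (fun s y => totalEnergyDensity (ρ s y) (u s y) (θ s y)) ht x]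
    exact h.energy t (hsub ht) x

/-! ## Decomposition D1 (time split) — typed, glued, and shown to be a costume -/

/-- **C″ — the pre-shock half** (byte-identical copy of `Cruxes/LocalSecondLaw/Restatement.lean :: LocalSecondLawPreShock`,
re-declared here so that this file imports only built modules): the filed text with `τ < T →` inserted after
`∀ τ : ℝ, 0 < τ →`. -/
def LocalSecondLawPreShock : Prop :=
  ∀ (a₀ θ₀ : Literature.MathematicalPhysics.KineticTheory.T3 → ℝ) (u₀ : Literature.MathematicalPhysics.KineticTheory.T3 → Literature.MathematicalPhysics.KineticTheory.V3), Continuous a₀ → Continuous θ₀ → Continuous u₀ → (∀ x, 0 < a₀ x) → (∀ x, 0 < θ₀ x) → ∃ σ₀ : ℝ, 0 < σ₀ ∧ ∀ σ : ℝ, 0 < σ → σ < σ₀ → ∀ (T : ℝ) (ρ θ : ℝ → Literature.MathematicalPhysics.KineticTheory.T3 → ℝ) (u : ℝ → Literature.MathematicalPhysics.KineticTheory.T3 → Literature.MathematicalPhysics.KineticTheory.V3), Literature.MathematicalPhysics.KineticTheory.IsHardSphereEulerSolution σ T ρ u θ → ∀ Φ : (N : ℕ) → Literature.Analysis.FluidPDE.HardSphereFlow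 (Literature.Analysis.FluidPDE.Torus.geometry (Fin 3)) (Literature.MathematicalPhysics.KineticTheory.hsDiameter σ N) (N + 1), Literature.MathematicalPhysics.KineticTheory.TendstoHydroFieldsAt (fun N => Literature.MathematicalPhysics.KineticTheory.localGibbsLaw σ a₀ u₀ θ₀ N (Φ N)) Φ ρ u θ 0 → 0 < T → ∀ τ : ℝ, 0 < τ → τ < T → ∀ φ : ℝ → Literature.MathematicalPhysics.KineticTheory.T3 → ℝ, Literature.Analysis.FunctionSpaces.Torus.IsSmoothSpaceTimeOn Set.univ φ → (∀ s x, 0 ≤ φ s x) → (∃ τ' : ℝ, τ' < τ ∧ ∀ s, τ' ≤ s → ∀ x, φ s x = 0) → ∀ η δ : ℝ, 0 < η → 0 < δ → ∃ r₀ : ℝ, 0 < r₀ ∧ ∀ r : ℝ, 0 < r → r < r₀ → ∃ N₀ : ℕ, ∀ N : ℕ, N₀ ≤ N → let γ : Literature.Analysis.FluidPDE.Config (N + 1) (Fin 3) Literature.MathematicalPhysics.KineticTheory.T3 → ℝ → Literature.Analysis.FluidPDE.Config (N + 1) (Fin 3) Literature.MathematicalPhysics.KineticTheory.T3 := fun z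 s => (Φ N).flow s z; let bx : Literature.MathematicalPhysics.KineticTheory.T3 → Literature.MathematicalPhysics.KineticTheory.T3 → ℝ := fun x y => 3 / (Real.pi * r ^ 3) * max (1 - Literature.Analysis.FluidPDE.Torus.euclidDist x y / r) 0; let ρm : Literature.Analysis.FluidPDE.Config (N + 1) (Fin 3) Literature.MathematicalPhysics.KineticTheory.T3 → ℝ → Literature.MathematicalPhysics.KineticTheory.T3 → ℝ := fun z s x₀ => ∫ q, bx q.1 x₀ ∂(Literature.Analysis.FluidPDE.empiricalMeasure (γ z s)); let mm : Literature.Analysis.FluidPDE.Config (N + 1) (Fin 3) Literature.MathematicalPhysics.KineticTheory.T3 → ℝ → Literature.MathematicalPhysics.KineticTheory.T3 → Literature.MathematicalPhysics.KineticTheory.V3 := fun z s x₀ => ∫ q, bx q.1 x₀ • q.2 ∂(Literature.Analysis.FluidPDE.empiricalMeasure (γ z s)); let em : Literature.Analysis.FluidPDE.Config (N + 1) (Fin 3) Literature.MathematicalPhysics.KineticTheory.T3 → ℝ → Literature.MathematicalPhysics.KineticTheory.T3 → ℝ := fun z s x₀ => ∫ q, bx q.1 x₀ * (‖q.2‖ ^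 2 / 2) ∂(Literature.Analysis.FluidPDE.empiricalMeasure (γ z s)); let θm : Literature.Analysis.FluidPDE.Config (N + 1) (Fin 3) Literature.MathematicalPhysics.KineticTheory.T3 → ℝ → Literature.MathematicalPhysics.KineticTheory.T3 → ℝ := fun z s x₀ => 2 / 3 * (em z s x₀ / ρm z s x₀ - ‖mm z s x₀‖ ^ 2 / (2 * ρm z s x₀ ^ 2)); let Hs : ℝ → ℝ → ℝ := fun a b => if 0 < a ∧ 0 < b then -(a * (3 / 2 * Real.log b - Real.log a - Literature.MathematicalPhysics.KineticTheory.hsExcessFreeEnergy (a * σ ^ 3))) else 0; let I : Literature.Analysis.FluidPDE.Config (N + 1) (Fin 3) Literature.MathematicalPhysics.KineticTheory.T3 → ℝ := fun z => ∫ s in Set.Icc (0 : ℝ) τ, ∫ x : Literature.MathematicalPhysics.KineticTheory.T3, Hs (ρm z s x) (θm z s x) * (deriv (fun s' => φ s' x) s + ∑ k : Fin 3, (mm z s x) k / ρm z s x * Literature.Analysis.FunctionSpaces.Torus.partialDeriv k (φ s) x); Literature.MathematicalPhysics.KineticTheory.localGibbsLaw σ a₀ u₀ θ₀ N (Φ N)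 {z | I z + ∫ x : Literature.MathematicalPhysics.KineticTheory.T3, Hs (ρ 0 x) (θ 0 x) * φ 0 x < -η} ≤ ENNReal.ofReal δ


/-- **The post-horizon half of the filed crux**: the route decl `Theses.JParityClosure.LocalSecondLaw`
byte-for-byte with the single extra hypothesis `T ≤ τ →` inserted after `∀ τ : ℝ, 0 < τ →` (the complement
of `Restatement.LocalSecondLawPreShock`, which inserts `τ < T →` at the same place). -/
def LocalSecondLawPostHorizon : Prop :=
  ∀ (a₀ θ₀ : Literature.MathematicalPhysics.KineticTheory.T3 → ℝ) (u₀ : Literature.MathematicalPhysics.KineticTheory.T3 → Literature.MathematicalPhysics.KineticTheory.V3), Continuous a₀ → Continuous θ₀ → Continuous u₀ → (∀ x, 0 < a₀ x) → (∀ x, 0 < θ₀ x) → ∃ σ₀ : ℝ, 0 < σ₀ ∧ ∀ σ : ℝ, 0 < σ → σ < σ₀ → ∀ (T : ℝ) (ρ θ : ℝ → Literature.MathematicalPhysics.KineticTheory.T3 → ℝ) (u : ℝ → Literature.MathematicalPhysics.KineticTheory.T3 → Literature.MathematicalPhysics.KineticTheory.V3), Literature.MathematicalPhysics.KineticTheory.IsHardSphereEulerSolution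 σ T ρ u θ → ∀ Φ : (N : ℕ) → Literature.Analysis.FluidPDE.HardSphereFlow (Literature.Analysis.FluidPDE.Torus.geometry (Fin 3)) (Literature.MathematicalPhysics.KineticTheory.hsDiameter σ N) (N + 1), Literature.MathematicalPhysics.KineticTheory.TendstoHydroFieldsAt (fun N => Literature.MathematicalPhysics.KineticTheory.localGibbsLaw σ a₀ u₀ θ₀ N (Φ N)) Φ ρ u θ 0 → 0 < T → ∀ τ : ℝ, 0 < τ → T ≤ τ → ∀ φ : ℝ → Literature.MathematicalPhysics.KineticTheory.T3 → ℝ, Literature.Analysis.FunctionSpaces.Torus.IsSmoothSpaceTimeOn Set.univ φ → (∀ s x, 0 ≤ φ s x) → (∃ τ' : ℝ, τ' < τ ∧ ∀ s, τ' ≤ s → ∀ x, φ s x = 0) → ∀ η δ : ℝ, 0 < η → 0 < δ → ∃ r₀ : ℝ, 0 < r₀ ∧ ∀ r : ℝ, 0 < r → r < r₀ → ∃ N₀ : ℕ, ∀ N : ℕ, N₀ ≤ N → let γ : Literature.Analysis.FluidPDE.Config (N + 1) (Fin 3) Literature.MathematicalPhysics.KineticTheory.T3 → ℝ → Literature.Analysis.FluidPDE.Config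 (N + 1) (Fin 3) Literature.MathematicalPhysics.KineticTheory.T3 := fun z s => (Φ N).flow s z; let bx : Literature.MathematicalPhysics.KineticTheory.T3 → Literature.MathematicalPhysics.KineticTheory.T3 → ℝ := fun x y => 3 / (Real.pi * r ^ 3) * max (1 - Literature.Analysis.FluidPDE.Torus.euclidDist x y / r) 0; let ρm : Literature.Analysis.FluidPDE.Config (N + 1) (Fin 3) Literature.MathematicalPhysics.KineticTheory.T3 → ℝ → Literature.MathematicalPhysics.KineticTheory.T3 → ℝ := fun z s x₀ => ∫ q, bx q.1 x₀ ∂(Literature.Analysis.FluidPDE.empiricalMeasure (γ z s)); let mm : Literature.Analysis.FluidPDE.Config (N + 1) (Fin 3) Literature.MathematicalPhysics.KineticTheory.T3 → ℝ → Literature.MathematicalPhysics.KineticTheory.T3 → Literature.MathematicalPhysics.KineticTheory.V3 := fun z s x₀ => ∫ q, bx q.1 x₀ • q.2 ∂(Literature.Analysis.FluidPDE.empiricalMeasure (γ z s)); let em : Literature.Analysis.FluidPDE.Config (N + 1) (Fin 3) Literature.MathematicalPhysics.KineticTheory.T3 → ℝ → Literature.MathematicalPhysics.KineticTheory.T3 →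 ℝ := fun z s x₀ => ∫ q, bx q.1 x₀ * (‖q.2‖ ^ 2 / 2) ∂(Literature.Analysis.FluidPDE.empiricalMeasure (γ z s)); let θm : Literature.Analysis.FluidPDE.Config (N + 1) (Fin 3) Literature.MathematicalPhysics.KineticTheory.T3 → ℝ → Literature.MathematicalPhysics.KineticTheory.T3 → ℝ := fun z s x₀ => 2 / 3 * (em z s x₀ / ρm z s x₀ - ‖mm z s x₀‖ ^ 2 / (2 * ρm z s x₀ ^ 2)); let Hs : ℝ → ℝ → ℝ := fun a b => if 0 < a ∧ 0 < b then -(a * (3 / 2 * Real.log b - Real.log a - Literature.MathematicalPhysics.KineticTheory.hsExcessFreeEnergy (a * σ ^ 3))) else 0; let I : Literature.Analysis.FluidPDE.Config (N + 1) (Fin 3) Literature.MathematicalPhysics.KineticTheory.T3 → ℝ := fun z => ∫ s in Set.Icc (0 : ℝ) τ, ∫ x : Literature.MathematicalPhysics.KineticTheory.T3, Hs (ρm z s x) (θm z s x) * (deriv (fun s' => φ s' x) s + ∑ k : Fin 3, (mm z s x) k / ρm z s x * Literature.Analysis.FunctionSpaces.Torus.partialDeriv k (φ s) x); Literature.MathematicalPhysics.KineticTheory.localGibbsLaw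 σ a₀ u₀ θ₀ N (Φ N) {z | I z + ∫ x : Literature.MathematicalPhysics.KineticTheory.T3, Hs (ρ 0 x) (θ 0 x) * φ 0 x < -η} ≤ ENNReal.ofReal δ

/-- The glue of the time split (honest and trivial): pre-shock half + post-horizon half ⇒ the filed crux,
by cases on `τ < T` after taking the smaller of the two `σ₀`. -/
theorem localSecondLaw_of_preShock_of_postHorizon (h₁ : LocalSecondLawPreShock)
    (h₂ : LocalSecondLawPostHorizon) : JParityClosure.LocalSecondLaw := by
  intro a₀ θ₀ u₀ ha hθ hu ha0 hθ0
  obtain ⟨σ₁, hσ₁, H₁⟩ := h₁ a₀ θ₀ u₀ ha hθ hu ha0 hθ0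
  obtain ⟨σ₂, hσ₂, H₂⟩ := h₂ a₀ θ₀ u₀ ha hθ hu ha0 hθ0
  refine ⟨min σ₁ σ₂, lt_min hσ₁ hσ₂, fun σ hσ hσ' T ρ θ u hE Φ h0 hT τ hτ => ?_⟩
  by_cases hlt : τ < T
  · exact H₁ σ hσ (lt_of_lt_of_le hσ' (min_le_left _ _)) T ρ θ u hE Φ h0 hT τ hτ hlt
  · exact H₂ σ hσ (lt_of_lt_of_le hσ' (min_le_right _ _)) T ρ θ u hE Φ h0 hT τ hτ (not_lt.mp hlt)

/-- The filed crux implies its post-horizon half (drop the hypothesis). -/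
theorem postHorizon_of_localSecondLaw (h : JParityClosure.LocalSecondLaw) : LocalSecondLawPostHorizon := by
  intro a₀ θ₀ u₀ ha hθ hu ha0 hθ0
  obtain ⟨σ₀, hσ₀, H⟩ := h a₀ θ₀ u₀ ha hθ hu ha0 hθ0
  exact ⟨σ₀, hσ₀, fun σ hσ hσ' T ρ θ u hE Φ h0 hT τ hτ _ => H σ hσ hσ' T ρ θ u hE Φ h0 hT τ hτ⟩

/-- **Costume certificate: the post-horizon half ALONE gives the filed crux.**  Given an instance with
`τ < T`, restrict the classical solution to the horizon `T' := τ` (`isHardSphereEulerSolution_restrict`);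
the `t = 0` LLN and the conclusion do not mention `T`.  So `T` (and the Euler PDE beyond its `t = 0`
slice) is idle in the filed decl, and the time split's second piece is the crux itself. -/
theorem localSecondLaw_of_postHorizon (h : LocalSecondLawPostHorizon) : JParityClosure.LocalSecondLaw := by
  intro a₀ θ₀ u₀ ha hθ hu ha0 hθ0
  obtain ⟨σ₀, hσ₀, H⟩ := h a₀ θ₀ u₀ ha hθ hu ha0 hθ0
  refine ⟨σ₀, hσ₀, fun σ hσ hσ' T ρ θ u hE Φ h0 hT τ hτ => ?_⟩
  by_cases hlt : τ < T
  · exact H σ hσ hσ' τ ρ θ u (isHardSphereEulerSolution_restrict hE hlt.le) Φ h0 hτ τ hτ le_rfl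
  · exact H σ hσ hσ' T ρ θ u hE Φ h0 hT τ hτ (not_lt.mp hlt)

/-- The post-horizon half is EQUIVALENT to the filed crux. -/
theorem localSecondLaw_iff_postHorizon : JParityClosure.LocalSecondLaw ↔ LocalSecondLawPostHorizon :=
  ⟨postHorizon_of_localSecondLaw, localSecondLaw_of_postHorizon⟩

/-! ## Strengthen S⁺ (Markov / law-free form) — typed, and shown to imply the crux -/

/-- **S⁺ — the law-free (Markov) strengthening.**  The filed text with the local Gibbs laws replaced by an
ARBITRARY family of probability laws `P N` on `(N+1)`-particle phase space satisfying the same `t = 0` LLN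
toward the Euler data (the profiles `(a₀, u₀, θ₀)` then play no role and are dropped; `∃ σ₀` is outermost).
This is the only hypothesis shape under which the local second law could be iterated over time windows
(restart at `s > 0` from the law `(Φₛ)_# P_N`, which is no longer local Gibbs).  On paper it is FALSE by
velocity reversal (reverse the velocities of an entropy-producing forward evolution of local Gibbs data:
the reversed laws satisfy the LLN toward a smooth profile and DEcrease the coarse-grained entropy), cf.
`Literature.Barriers.AtomisticToContinuum.VelocityReversalBarrier`; a Lean witness would need an
entropy-producing evolution, which is not constructible (Disproof.lean §(a), last bullet). -/
def LocalSecondLawAnyLaw : Prop :=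
  ∃ σ₀ : ℝ, 0 < σ₀ ∧ ∀ σ : ℝ, 0 < σ → σ < σ₀ → ∀ (T : ℝ) (ρ θ : ℝ → Literature.MathematicalPhysics.KineticTheory.T3 → ℝ) (u : ℝ → Literature.MathematicalPhysics.KineticTheory.T3 → Literature.MathematicalPhysics.KineticTheory.V3), Literature.MathematicalPhysics.KineticTheory.IsHardSphereEulerSolution σ T ρ u θ → ∀ Φ : (N : ℕ) → Literature.Analysis.FluidPDE.HardSphereFlow (Literature.Analysis.FluidPDE.Torus.geometry (Fin 3)) (Literature.MathematicalPhysics.KineticTheory.hsDiameter σ N) (N + 1), ∀ P : (N : ℕ) → MeasureTheory.Measure (Literature.Analysis.FluidPDE.Config (N + 1) (Fin 3) Literature.MathematicalPhysics.KineticTheory.T3), (∀ N, MeasureTheory.IsProbabilityMeasure (P N)) → Literature.MathematicalPhysics.KineticTheory.TendstoHydroFieldsAt P Φ ρ u θ 0 → 0 < T → ∀ τ : ℝ, 0 < τ → ∀ φ : ℝ → Literature.MathematicalPhysics.KineticTheory.T3 → ℝ, Literature.Analysis.FunctionSpaces.Torus.IsSmoothSpaceTimeOn Set.univ φ → (∀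 s x, 0 ≤ φ s x) → (∃ τ' : ℝ, τ' < τ ∧ ∀ s, τ' ≤ s → ∀ x, φ s x = 0) → ∀ η δ : ℝ, 0 < η → 0 < δ → ∃ r₀ : ℝ, 0 < r₀ ∧ ∀ r : ℝ, 0 < r → r < r₀ → ∃ N₀ : ℕ, ∀ N : ℕ, N₀ ≤ N → let γ : Literature.Analysis.FluidPDE.Config (N + 1) (Fin 3) Literature.MathematicalPhysics.KineticTheory.T3 → ℝ → Literature.Analysis.FluidPDE.Config (N + 1) (Fin 3) Literature.MathematicalPhysics.KineticTheory.T3 := fun z s => (Φ N).flow s z; let bx : Literature.MathematicalPhysics.KineticTheory.T3 → Literature.MathematicalPhysics.KineticTheory.T3 → ℝ := fun x y => 3 / (Real.pi * r ^ 3) * max (1 - Literature.Analysis.FluidPDE.Torus.euclidDist x y / r) 0; let ρm : Literature.Analysis.FluidPDE.Config (N + 1) (Fin 3) Literature.MathematicalPhysics.KineticTheory.T3 → ℝ → Literature.MathematicalPhysics.KineticTheory.T3 → ℝ := fun z s x₀ => ∫ q, bx q.1 x₀ ∂(Literature.Analysis.FluidPDE.empiricalMeasure (γ z s)); let mm : Literature.Analysis.FluidPDE.Config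 (N + 1) (Fin 3) Literature.MathematicalPhysics.KineticTheory.T3 → ℝ → Literature.MathematicalPhysics.KineticTheory.T3 → Literature.MathematicalPhysics.KineticTheory.V3 := fun z s x₀ => ∫ q, bx q.1 x₀ • q.2 ∂(Literature.Analysis.FluidPDE.empiricalMeasure (γ z s)); let em : Literature.Analysis.FluidPDE.Config (N + 1) (Fin 3) Literature.MathematicalPhysics.KineticTheory.T3 → ℝ → Literature.MathematicalPhysics.KineticTheory.T3 → ℝ := fun z s x₀ => ∫ q, bx q.1 x₀ * (‖q.2‖ ^ 2 / 2) ∂(Literature.Analysis.FluidPDE.empiricalMeasure (γ z s)); let θm : Literature.Analysis.FluidPDE.Config (N + 1) (Fin 3) Literature.MathematicalPhysics.KineticTheory.T3 → ℝ → Literature.MathematicalPhysics.KineticTheory.T3 → ℝ := fun z s x₀ => 2 / 3 * (em z s x₀ / ρm z s x₀ - ‖mm z s x₀‖ ^ 2 / (2 * ρm z s x₀ ^ 2)); let Hs : ℝ → ℝ → ℝ := fun a b => if 0 < a ∧ 0 < b then -(a * (3 / 2 * Real.log b - Real.log a - Literature.MathematicalPhysics.KineticTheory.hsExcessFreeEnergy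 (a * σ ^ 3))) else 0; let I : Literature.Analysis.FluidPDE.Config (N + 1) (Fin 3) Literature.MathematicalPhysics.KineticTheory.T3 → ℝ := fun z => ∫ s in Set.Icc (0 : ℝ) τ, ∫ x : Literature.MathematicalPhysics.KineticTheory.T3, Hs (ρm z s x) (θm z s x) * (deriv (fun s' => φ s' x) s + ∑ k : Fin 3, (mm z s x) k / ρm z s x * Literature.Analysis.FunctionSpaces.Torus.partialDeriv k (φ s) x); P N {z | I z + ∫ x : Literature.MathematicalPhysics.KineticTheory.T3, Hs (ρ 0 x) (θ 0 x) * φ 0 x < -η} ≤ ENNReal.ofReal δ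

/-- S⁺ implies the filed crux (specialise `P N` to the local Gibbs laws, probability measures for
`σ ≤ 1/2` by `isProbabilityMeasure_localGibbsLaw`). -/
theorem localSecondLaw_of_anyLaw (h : LocalSecondLawAnyLaw) : JParityClosure.LocalSecondLaw := by
  intro a₀ θ₀ u₀ ha hθ hu ha0 hθ0
  obtain ⟨σ₀, hσ₀, H⟩ := h
  refine ⟨min σ₀ (1 / 2), lt_min hσ₀ (by norm_num), fun σ hσ hσ' T ρ θ u hE Φ h0 hT => ?_⟩
  have hσ₁ : σ < σ₀ := lt_of_lt_of_le hσ' (min_le_left _ _)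
  have hσ₂ : σ ≤ 1 / 2 := (lt_of_lt_of_le hσ' (min_le_right _ _)).le
  exact H σ hσ hσ₁ T ρ θ u hE Φ (fun N => localGibbsLaw σ a₀ u₀ θ₀ N (Φ N))
    (fun N => isProbabilityMeasure_localGibbsLaw ha hθ hu ha0 hθ0 hσ₂ N (Φ N)) h0 hT


/-! ## Negation N2 — the typed equation of state is JUNK above close packing

`hsExcessFreeEnergy η = limsup_N (−N⁻¹ log hsFreeVolume η N)`; for `η > 6/π` the separated-configuration set is
EMPTY for all large `N` (disjoint closed minimal-image balls of radius `d/2`, `d³ = η/N`, would have total Haar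
volume `(π/6)η > 1`), so `hsFreeVolume = 0`, `Real.log 0 = 0` and the typed excess free energy is `0` there
(the physical value is `+∞`).  This junk branch is nevertheless UNREACHABLE by the crux's functional: the cone
kernel is normalised (`∫ b_r = 1`) and hard-core exclusion caps the density of centres, so on good configurations
`ρ_r σ³ ≤ 6/π + O(ε_N/r)` (elementary disjoint-ball count; `≤ √2 + o(1)` by Kepler/Hales) — see the census
`## Negation`, N2: the negation attempt through EOS junk fails for exactly this reason, and what it leaves is a
prover-side fact (the typed EOS is honest wherever the particle system can take it). -/

/-- **No separated configuration above `η = 6/π`.**  For `6/π < η < N`, `2 ≤ N`, no `N` points of `𝕋³` have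
pairwise minimal-image distances `> (η/N)^{1/3}`. [folklore] -/
theorem hsSepSet_eq_empty {η : ℝ} (hη : 6 / Real.pi < η) {N : ℕ} (hN2 : 2 ≤ N) (hNη : η < N) :
    {q : Fin N → T3 | ∀ i j, i ≠ j →
      (η / N) ^ (1 / 3 : ℝ) < Literature.Analysis.FluidPDE.Torus.euclidDist (q i) (q j)} = ∅ := by
  have hpi3 := Real.pi_gt_three
  have hpi0 : 0 < Real.pi := Real.pi_pos
  have h6 : 0 < 6 / Real.pi := by positivity
  have hη0 : 0 < η := lt_trans h6 hη
  have hNpos : 0 < (N : ℝ) := by exact_mod_cast (show 0 < N by omega)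
  set d : ℝ := (η / N) ^ (1 / 3 : ℝ) with hd
  have hx0 : 0 ≤ η / N := by positivity
  have hd0 : 0 ≤ d := Real.rpow_nonneg hx0 _
  have hd3 : d ^ 3 = η / N := by
    rw [hd, one_div]; exact Real.rpow_inv_natCast_pow hx0 (by norm_num)
  have hd1 : d < 1 := by
    have h : d ^ 3 < 1 ^ 3 := by
      rw [hd3, one_pow, div_lt_one hNpos]; exact hNη
    exact lt_of_pow_lt_pow_left₀ 3 (by norm_num) h
  have hr : d / 2 < 1 / 2 := by linarith
  have hr0 : 0 ≤ d / 2 := by linarith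
  rw [Set.eq_empty_iff_forall_notMem]
  intro q hq
  simp only [Set.mem_setOf_eq] at hq
  -- the closed minimal-image balls of radius d/2 around the points
  set B : Fin N → Set T3 := fun i => {x | Torus.euclidDist x (q i) ≤ d / 2} with hB
  have hBmeas : ∀ i, MeasurableSet (B i) := fun i =>
    (isClosed_le (Summit.AtomisticToContinuum.HydrodynamicLimit.Theorems.LocalSecondLawNegative.continuous_euclidDist_comp
      continuous_id continuous_const)
      continuous_const).measurableSet
  have hdisj : Pairwise (Function.onFun Disjoint B) := by
    intro i j hij
    rw [Function.onFun, Set.disjoint_left]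
    intro x hxi hxj
    have hxi' : Torus.euclidDist x (q i) ≤ d / 2 := hxi
    have hxj' : Torus.euclidDist x (q j) ≤ d / 2 := hxj
    have htri := Torus.euclidDist_triangle (q i) x (q j)
    rw [Torus.euclidDist_comm (q i) x] at htri
    have := hq i j hij
    linarith
  have hball : ∀ i, volume (B i) = ENNReal.ofReal (4 * Real.pi / 3 * (d / 2) ^ 3) := by
    intro i
    rw [hB]
    simp only
    rw [Torus.volume_euclidDist_le hr (q i), EuclideanSpace.volume_closedBall_fin_three,
      ← ENNReal.ofReal_pow hr0, ← ENNReal.ofReal_mul (by positivity)]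
    congr 1; ring
  have hU : volume (⋃ i, B i) = ENNReal.ofReal (Real.pi / 6 * η) := by
    rw [measure_iUnion hdisj hBmeas, tsum_fintype]
    simp_rw [hball]
    rw [Finset.sum_const, Finset.card_univ, Fintype.card_fin, nsmul_eq_mul, ← ENNReal.ofReal_natCast,
      ← ENNReal.ofReal_mul (Nat.cast_nonneg N)]
    congr 1
    have : (N : ℝ) * (4 * Real.pi / 3 * (d / 2) ^ 3) = Real.pi / 6 * ((N : ℝ) * d ^ 3) := by ring
    rw [this, hd3]; field_simp
  have hle : volume (⋃ i, B i) ≤ 1 := prob_le_one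
  rw [hU, ENNReal.ofReal_le_one] at hle
  have hgt : 1 < Real.pi / 6 * η := by
    have := (div_lt_iff₀ hpi0).1 hη
    nlinarith
  linarith

/-- **The free volume vanishes above `η = 6/π`** (for `N > η`, `N ≥ 2`). [folklore] -/
theorem hsFreeVolume_eq_zero_of_gt {η : ℝ} (hη : 6 / Real.pi < η) {N : ℕ} (hN2 : 2 ≤ N) (hNη : η < N) :
    hsFreeVolume η N = 0 := by
  unfold hsFreeVolume
  rw [hsSepSet_eq_empty hη hN2 hNη, measure_empty, ENNReal.toReal_zero]

/-- **EOS junk above close packing**: `hsExcessFreeEnergy η = 0` for every `η > 6/π` (≈ 1.91; close packing is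
`√2 ≈ 1.41`), because every term of the defining `limsup` is eventually `−N⁻¹ · Real.log 0 = 0`.  The physical
excess free energy is `+∞` there; the typed hard-sphere entropy `H` therefore reads the IDEAL-GAS value on
centre-jammed balls. [folklore] -/
theorem hsExcessFreeEnergy_eq_zero_of_gt {η : ℝ} (hη : 6 / Real.pi < η) : hsExcessFreeEnergy η = 0 := by
  unfold hsExcessFreeEnergy
  have hev : (fun N : ℕ => -(N : ℝ)⁻¹ * Real.log (hsFreeVolume η N)) =ᶠ[atTop] fun _ => (0 : ℝ) := by
    rw [Filter.EventuallyEq, Filter.eventually_atTop]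
    refine ⟨max 2 (⌈η⌉₊ + 1), fun N hN => ?_⟩
    have hN2 : 2 ≤ N := le_trans (le_max_left _ _) hN
    have hNη : η < N := by
      have h1 : ⌈η⌉₊ + 1 ≤ N := le_trans (le_max_right _ _) hN
      have h2 : ((⌈η⌉₊ : ℕ) : ℝ) + 1 ≤ N := by exact_mod_cast h1
      linarith [Nat.le_ceil η]
    rw [hsFreeVolume_eq_zero_of_gt hη hN2 hNη, Real.log_zero, mul_zero]
  rw [Filter.limsup_congr hev, Filter.limsup_const]

end Summit.AtomisticToContinuum.HydrodynamicLimit.Cruxes.LocalSecondLaw.StrategyCensus
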